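import Literature.AlgebraicGeometry.Morphisms.CechH0Projective
import Literature.AlgebraicGeometry.Motives.ProjBaseChangeAny
import Mathlib.AlgebraicGeometry.Morphisms.Separated
import Mathlib.AlgebraicGeometry.Modules.Sheaf
import HarnessLib

/-!
# Sections of `𝒪_Y` over preimages of affine opens, for `Y` projective over `A` mapping to a separated `A`-scheme

Let `f : X → Spec A` be separated, `g : Y → X` an `A`-morphism from a scheme `Y` admitting a
closed `A`-immersion `ι : Y ↪ 𝐏ⁿ_A` (`ι ≫ (𝐏ⁿ_A → Spec A) = g ≫ f`). Then for every affine open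
`W = Spec B ⊆ X`, the preimage `g⁻¹W` is a closed subscheme of `𝐏ⁿ_B = 𝐏ⁿ_A ×_A Spec B`
(`Literature/AlgebraicGeometry/Motives/ProjBaseChangeAny`: the graph `Y → 𝐏ⁿ_A ×_A X` is a closed
immersion since `f` is separated, Mathlib `IsClosedImmersion.of_comp`, and closed immersions are
stable under base change), so by the degree-`0` finiteness for closed subschemes of projective
space (`Literature/AlgebraicGeometry/Morphisms/CechH0Projective`) **`Γ(g⁻¹W, 𝒪_Y)` is a finitely
generated `Γ(W, 𝒪_X)`-module** (`moduleFinite_sections_preimage`; `B` Noetherian). This is the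
coherence of `g_*𝒪_Y` for a projective morphism (Hartshorne III Cor. 5.20 / Thm. 5.2 (a) in the
relative form over an affine base; Görtz–Wedhorn II, Thm. 23.17 case `i = 0`), in the affine-local
form `Γ(W, g_*𝒪_Y)` finite over `Γ(W, 𝒪_X)` used by the dévissage of `cechH1_finite`.

* `fromSpec_comp_eq` — `Spec B → X → Spec A` is `Spec` of `A → Γ(X, 𝒪_X) → B`;
* `isClosedImmersion_graphLift` — `Y → 𝐏ⁿ_A ×_A X` is a closed immersion;
* `moduleFinite_sections_preimage` — the theorem.

Everything is proved; no named facts. Mathlib searched (pin v4.32): `Scheme.toSpecΓ_naturality`,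
`IsAffineOpen.fromSpec_toSpecΓ`, `isoSpec_hom_fromSpec`, `isoSpec_hom_appTop`, `isPullback_morphismRestrict`,
`morphismRestrict_ι`, `IsPullback.of_right`, `IsPullback.of_iso`, `IsClosedImmersion.of_comp`,
`MorphismProperty.of_isPullback` (used).

## References

* R. Hartshorne, *Algebraic Geometry*, GTM 52 (1977): III Thm. 5.2 (a) (p. 228), II Cor. 4.8, Ex. 4.8.
  [Hartshorne1977]
* U. Görtz, T. Wedhorn, *Algebraic Geometry II* (2023): Thm. 23.17, p. 424. [GortzWedhorn2023]
-/

noncomputable section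

open CategoryTheory CategoryTheory.Limits AlgebraicGeometry TopologicalSpace Opposite

universe u

namespace Literature.AlgebraicGeometry.Morphisms

attribute [local instance] MvPolynomial.gradedAlgebra

variable {A : Type u} [CommRing A] {X Y : Scheme.{u}} (f : X ⟶ Spec (.of A)) (g : Y ⟶ X) {n : ℕ}
  (ιY : Y ⟶ ProjCech.PP A n) (hι : ιY ≫ ProjCech.toSpec A n = g ≫ f)

/-- The ring map `A → Γ(X, 𝒪_X) → Γ(W, 𝒪_X)` of an open `W` of an `A`-scheme. [folklore] -/
abbrev resAlgebraMapΓ (W : X.Opens) : A →+* Γ(X, W) :=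
  (X.presheaf.map (homOfLE (le_top : W ≤ ⊤)).op).hom.comp (algebraMapΓ f)

/-- **`Spec Γ(W, 𝒪_X) → X → Spec A` is `Spec` of `A → Γ(X, 𝒪_X) → Γ(W, 𝒪_X)`** for an affine open `W`.
[folklore] -/
theorem fromSpec_comp_eq {W : X.Opens} (hW : IsAffineOpen W) :
    hW.fromSpec ≫ f = Spec.map (CommRingCat.ofHom (resAlgebraMapΓ f W)) := by
  have e1 : X.toSpecΓ ≫ Spec.map f.appTop ≫ Spec.map (Scheme.ΓSpecIso (.of A)).inv = f := by
    rw [← Category.assoc, ← Scheme.toSpecΓ_naturality, Category.assoc,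
      toSpecΓ_SpecMap_ΓSpecIso_inv, Category.comp_id]
  nth_rw 1 [← e1]
  rw [hW.fromSpec_toSpecΓ_assoc, ← Spec.map_comp, ← Spec.map_comp]
  rfl

/-- The "graph" `Y → 𝐏ⁿ_A ×_A X` of `g` along the closed immersion `ι`. [folklore] -/
abbrev graphLift : Y ⟶ pullback (ProjCech.toSpec A n) f := pullback.lift ιY g hι

/-- **`Y → 𝐏ⁿ_A ×_A X` is a closed immersion** (`ι` is, and the projection to `𝐏ⁿ_A` is separated,
being a base change of the separated `f`). [cite: Hartshorne1977, II Cor. 4.8 (e)] -/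
theorem isClosedImmersion_graphLift [IsClosedImmersion ιY] [IsSeparated f] :
    IsClosedImmersion (graphLift f g ιY hι) := by
  haveI : IsClosedImmersion (graphLift f g ιY hι ≫ pullback.fst (ProjCech.toSpec A n) f) := by
    rw [pullback.lift_fst]; infer_instance
  exact IsClosedImmersion.of_comp (graphLift f g ιY hι) (pullback.fst (ProjCech.toSpec A n) f)

include ιY hι in
/-- **`Γ(g⁻¹W, 𝒪_Y)` is a finitely generated `Γ(W, 𝒪_X)`-module** for every affine open `W ⊆ X` with
`Γ(W, 𝒪_X)` Noetherian, when `Y` is a closed `A`-subscheme of `𝐏ⁿ_A` and `f : X → Spec A` is separated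
(the module structure being that of `Γ(W, g_*𝒪_Y)`, through `g^* : Γ(W, 𝒪_X) → Γ(g⁻¹W, 𝒪_Y)`).
[cite: Hartshorne1977, III Thm. 5.2 (a) (p. 228)] -/
theorem moduleFinite_sections_preimage [IsClosedImmersion ιY] [IsSeparated f] {W : X.Opens}
    (hW : IsAffineOpen W) [IsNoetherianRing Γ(X, W)] :
    Module.Finite Γ(X, W)
      Γ((Scheme.Modules.pushforward g).obj (SheafOfModules.unit Y.ringCatSheaf), W) := by
  -- notation
  letI : Algebra A Γ(X, W) := (resAlgebraMapΓ f W).toAlgebra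
  have hP := Motives.ProjBaseChangeRing.isPullback_projMap' A Γ(X, W) (n := n)
  set pA := ProjCech.toSpec A n with hpA
  set pB : ProjCech.PP Γ(X, W) n ⟶ Spec (.of Γ(X, W)) := ProjCech.toSpec Γ(X, W) n with hpB
  set sB : Spec (.of Γ(X, W)) ⟶ Spec (.of A) := Spec.map (CommRingCat.ofHom (algebraMap A Γ(X, W))) with hsBdef
  set m := Proj.map (Motives.ProjBaseChangeRing.mapGraded A Γ(X, W) (Fin (n + 1)))
    (Motives.ProjBaseChangeRing.irrelevant_le_map A Γ(X, W) (Fin (n + 1))) with hm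
  have hsB : hW.fromSpec ≫ f = sB := fromSpec_comp_eq f hW
  -- `𝐏ⁿ_A ×_A X` and the graph
  let p₁ := pullback.fst pA f
  let p₂ := pullback.snd pA f
  let γ := graphLift f g ιY hι
  haveI : IsClosedImmersion γ := isClosedImmersion_graphLift f g ιY hι
  -- `𝐏ⁿ_B → 𝐏ⁿ_A ×_A X`
  let m' : ProjCech.PP Γ(X, W) n ⟶ pullback pA f :=
    pullback.lift m (pB ≫ hW.fromSpec) (by rw [Category.assoc, hsB]; exact hP.w)
  have hL : IsPullback m' pB p₂ hW.fromSpec := by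
    refine IsPullback.of_right (h₁₂ := p₁) (v₁₃ := pA) (h₂₂ := f) ?_ (pullback.lift_snd _ _ _) (IsPullback.of_hasPullback pA f)
    rw [pullback.lift_fst, hsB]
    exact hP
  -- the preimage `g⁻¹W` and its map to `𝐏ⁿ_B`
  let jY := (g ⁻¹ᵁ W).ι
  let b : (g ⁻¹ᵁ W : Y.Opens).toScheme ⟶ Spec (.of Γ(X, W)) := (g ∣_ W) ≫ hW.isoSpec.hom
  let a : (g ⁻¹ᵁ W : Y.Opens).toScheme ⟶ ProjCech.PP A n := jY ≫ ιY
  have hab : a ≫ pA = b ≫ sB := by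
    change ((g ⁻¹ᵁ W).ι ≫ ιY) ≫ ProjCech.toSpec A n = ((g ∣_ W) ≫ hW.isoSpec.hom) ≫ sB
    rw [Category.assoc, hι, ← Category.assoc, ← morphismRestrict_ι, Category.assoc, Category.assoc,
      ← hsB, hW.isoSpec_hom_fromSpec_assoc]
  let c : (g ⁻¹ᵁ W : Y.Opens).toScheme ⟶ ProjCech.PP Γ(X, W) n := hP.lift a b hab
  have hcm : c ≫ m = a := hP.lift_fst a b hab
  have hcb : c ≫ pB = b := hP.lift_snd a b hab
  -- outer square `g⁻¹W → Spec B` over `Y → X`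
  have hout : IsPullback b jY hW.fromSpec g := by
    refine (isPullback_morphismRestrict g W).of_iso (Iso.refl _) hW.isoSpec (Iso.refl _) (Iso.refl _)
      (by simp [b]) (by simp [jY]) (by rw [Iso.refl_hom, Category.comp_id, hW.isoSpec_hom_fromSpec]) (by simp)
  -- hence `c` is a base change of the closed immersion `γ`
  have hsq : IsPullback c jY m' γ := by
    refine IsPullback.of_right (h₁₂ := pB) (v₁₃ := hW.fromSpec) (h₂₂ := p₂) ?_ ?_ hL.flip
    · rw [hcb, show γ ≫ p₂ = g from pullback.lift_snd _ _ _]; exact hout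
    · apply pullback.hom_ext
      · rw [Category.assoc, Category.assoc, pullback.lift_fst, hcm, pullback.lift_fst]
      · rw [Category.assoc, Category.assoc, pullback.lift_snd, pullback.lift_snd, ← Category.assoc, hcb,
          Category.assoc, hW.isoSpec_hom_fromSpec, morphismRestrict_ι]
  haveI : IsClosedImmersion c := MorphismProperty.of_isPullback hsq.flip inferInstance
  -- degree-0 finiteness over `B = Γ(W, 𝒪_X)`
  haveI hfin : Module.Finite Γ(X, W) (Sections (c ≫ pB) ⊤) :=
    moduleFinite_sections_top_of_isClosedImmersion (c ≫ pB) c rfl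
  -- the `B`-action on `Γ(g⁻¹W, ⊤)` read in `Γ(Y, g⁻¹W)`
  have hact : ∀ b : Γ(X, W), (g ⁻¹ᵁ W).topIso.hom (algebraMapΓ (c ≫ pB) b) = g.app W b := by
    intro b
    have e1 : (c ≫ pB).appTop = ((g ∣_ W) ≫ hW.isoSpec.hom).appTop := by rw [hcb]
    rw [algebraMapΓ, RingHom.comp_apply, e1, Scheme.Hom.comp_appTop, hW.isoSpec_hom_appTop,
      ← Scheme.Hom.resLE_eq_morphismRestrict, Scheme.Hom.appTop, Scheme.Hom.resLE_app_top,
      ← Scheme.Hom.app_eq_appLE]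
    change ((Scheme.ΓSpecIso Γ(X, W)).inv ≫ ((Scheme.ΓSpecIso Γ(X, W)).hom ≫ W.topIso.inv) ≫
      (W.topIso.hom ≫ g.app W ≫ (g ⁻¹ᵁ W).topIso.inv) ≫ (g ⁻¹ᵁ W).topIso.hom) b = g.app W b
    simp only [Category.assoc, Iso.inv_hom_id_assoc, Iso.inv_hom_id, Category.comp_id]
  -- transport along `Γ(g⁻¹W, ⊤) ≅ Γ(Y, g⁻¹W)`
  let e : Sections (c ≫ pB) ⊤ →ₗ[Γ(X, W)]
      Γ((Scheme.Modules.pushforward g).obj (SheafOfModules.unit Y.ringCatSheaf), W) :=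
    { toFun := fun s => (g ⁻¹ᵁ W).topIso.hom s
      map_add' := fun s t => map_add ((g ⁻¹ᵁ W).topIso.hom).hom s t
      map_smul' := fun b s => by
        have h2 : (((g ⁻¹ᵁ W : Y.Opens).toScheme).presheaf.map
            (homOfLE (le_top : (⊤ : ((g ⁻¹ᵁ W : Y.Opens).toScheme).Opens) ≤ ⊤)).op) = 𝟙 _ := by
          rw [show (homOfLE (le_top : (⊤ : ((g ⁻¹ᵁ W : Y.Opens).toScheme).Opens) ≤ ⊤)).op = 𝟙 _ from
            Subsingleton.elim _ _, CategoryTheory.Functor.map_id]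
        rw [RingHom.id_apply, Algebra.smul_def, Sections.algebraMap_apply, h2, CategoryTheory.id_apply]
        erw [map_mul]
        rw [hact]
        rfl }
  exact Module.Finite.of_surjective e fun t => ⟨(g ⁻¹ᵁ W).topIso.inv t, by
    change (g ⁻¹ᵁ W).topIso.hom ((g ⁻¹ᵁ W).topIso.inv t) = t
    rw [← CategoryTheory.comp_apply, Iso.inv_hom_id]; rfl⟩

end Literature.AlgebraicGeometry.Morphisms

end
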